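import Mathlib
import HarnessLib
import Summits.SmoothPoincare4.SmoothPoincare4.Theses.EntropyLadder
import Literature.Geometry.Riemannian.LowEntropyHypersurfacesFour
import Literature.Topology.FourManifolds.Handles
import Literature.Topology.FourManifolds.ClosedBallHandles
import Literature.Topology.FourManifolds.CerfGammaFourProofs
import Literature.Topology.FourManifolds.HomotopyS4Freedman

/-!
# Line `birth` — BC3 skeleton for the crux `ThinSpheresBoundTwoHandlebodies` (stmt-SmoothPoincare4-3718)

Route `EntropyLadder` (route-SmoothPoincare4-EntropyLadder, crux G, rank 3), skeleton registrar
planner-skel-stmt-SmoothPoincare4-3718-0, 2026-08-17.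

The crux (`Summit.SmoothPoincare4.SmoothPoincare4.Theses.EntropyLadder.ThinSpheresBoundTwoHandlebodies`,
G of the thesis E ∧ G ∧ T): a homotopy 4-sphere `M` smoothly embedded in `ℝ⁵` by `ι` with
Colding–Minicozzi entropy `ent(range ι) < ent(S¹(√2) × ℝ³)` (the inline un-normalised functional,
`= λ(S¹ × ℝ³) ≈ 1.5203` after normalisation) bounds a compact CONTRACTIBLE smooth 5-manifold `W`
with a Morse function adapted to `∂W` all of whose critical points have index `≤ 2`
(`IsHandlebodyOfIndexLE 4 2 W` unfolded) and `∂W = M`.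

## The line = the entropy ladder read rung by rung, typed over tree declarations

Write `λ₄ = gaussianEntropy 4` and `Cyl_k = shrinkingCylinder 4 k = Sᵏ(√(2k)) × ℝ⁴⁻ᵏ ⊂ ℝ⁵`
(`ColdingMinicozziEntropyValues.lean`; `λ₄(Cyl_k) = λ(Sᵏ)` by Stone, `λ(S²) = 4/e ≈ 1.4715 <
λ(S¹) ≈ 1.5203`). The crux hypothesis is `λ₄(range ι) < λ₄(Cyl₁)` (`gaussianEntropy_four_lt_iff` +
`shrinkingCylinder_four_one`, used in `ThinSpheresBoundTwoHandlebodies_of`). Split the entropy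
range at the PROVED rung `λ₄(Cyl₂)`:

* `stub_lowRungFilling` — RUNG 2 IN FILLING FORM (KNOWN modulo one named fact of the tree; the
  sorry-free derivation `lowRungFilling_of_CMS` is in this file). If `M ≃ₕ S⁴` is embedded with
  `λ₄(range ι) ≤ λ₄(Cyl₂)` then `M` bounds a compact contractible `5`-dimensional `2`-handlebody:
  Chodosh–Mantoulidis–Schulze 2025 Cor. 1.5 (b) / 1.22 (b) (`n = 4`, unconditional; vendored as the
  named fact `ChodoshMantoulidisSchulze2025_lowEntropy_sphere_four`, clause (b), simply connected
  case) gives `M ≅ S⁴`, and `S⁴ = ∂𝔻⁵` with `𝔻⁵` contractible and a `0`-handle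
  (`isHandlebodyOfIndexLE_closedBall`, `isSmoothEmbedding_sphereInclusion'_holds`,
  `range_inclusion_eq_boundary` — all proved in the tree; `boundsFilling_of_diffeomorph_sphere`
  below). Mechanism in print: generic perturbation (CMS Thm. 1.17) + only `S⁴`/`S³ × ℝ`
  singularities below `λ(S²)` + Daniels-Holgate neck surgery.
* `stub_windowFilling` — THE WINDOW `λ₄(Cyl₂) < λ₄(range ι) < λ₄(Cyl₁)` (OPEN; load-bearing;
  hardest). Every compact connected `4`-manifold `M` (no homotopy-sphere hypothesis!) smoothly
  embedded in `ℝ⁵` with entropy in the window bounds a compact `5`-manifold `W` with an adapted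
  Morse function of index `≤ 2` (`IsHandlebodyOfIndexLE 4 2 W`) and `∂W = M` — contractibility is
  NOT claimed here. Mechanism: CMS 2025 Thm. 1.3 / Cor. 1.19 (`λ ≤ 2` in `ℝ⁵`: arbitrarily small
  `C^∞` graphs `M'` over `ι(M)` whose level-set flow has only multiplicity-one `S⁴`, `S³ × ℝ`,
  `S² × ℝ²`, `S¹ × ℝ³` singularities; THEOREM), Huisken monotonicity + `λ(M') < λ(S¹)` exclude the
  `S¹ × ℝ³ = 𝒞_{4,3}` ones (density `λ(S¹)`), IF the remaining cylindrical singularities can be made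
  NONDEGENERATE by a further perturbation (Sun–Wang–Xue 2025 Conjecture 1.4 restricted to
  `λ < λ(S¹)` in `ℝ⁵` — the OPEN input; local genericity Sun–Xue 2022) then Sun–Wang–Xue 2025
  Thm. 1.1 + Cor. 1.3 / 1.6 (THEOREM): the spacetime track `W = spt ℳ ⊂ ℝ⁵ × ℝ` is a compact smooth
  `5`-manifold with `∂W = M' × {0}`, obtained from finitely many balls (one per spherical
  singularity, index `n - k + 1 = 5` of the time function) by attaching one `k`-handle per
  `𝒞_{4,k} = S⁴⁻ᵏ × ℝᵏ` singular point, `k ∈ {1, 2}` (index `5 - k` of the time function `𝔱`; the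
  adapted Morse function is `1 - 𝔱/T`, regular on `∂W` because `d𝔱 ≠ 0` at regular points of the
  flow); finally `M' ≅ M` (normal graph). In the window bubble-sheet singularities `S² × ℝ²` DO occur
  and no surgery exists for them (Daniels-Holgate is neck-only) — this is exactly where SWX
  nondegeneracy is needed, which is why the cut is at `λ₄(Cyl₂)`.
* `stub_fillingContractible` — TOPOLOGY OF THE FILLING (KNOWN mathematics; size L–XL in Lean). A
  compact `5`-manifold `W` with an adapted Morse function of index `≤ 2` whose boundary is (the
  image of a smooth embedding of) a homotopy `4`-sphere is contractible: `W ≠ ∅`; a closed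
  component would carry an interior maximum = a critical point of index `5 > 2`, so `W` is
  connected with `∂W ≅ M` connected; `W ≃` a finite CW complex of dimension `≤ 2`
  (`IsHandlebodyOfIndexLE.exists_finite_cwComplex_homotopyEquiv`, Milnor 1963 Thm. 3.5 — in the
  tree); dually `W = ∂W × I ∪` handles of index `≥ 3`, so `π₁(W) ≅ π₁(∂W) = 1`; `H₂(∂W) = 0 →
  H₂(W) → H₂(W, ∂W) ≅ H³(W) = 0` (Lefschetz duality, cf. `NullCobordismBoundaryHomology.lean`), so
  `W` is simply connected and acyclic, hence contractible (Whitehead; Hatcher Thm. 4.5 / Cor. 4.33).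

`ThinSpheresBoundTwoHandlebodies_of : Sig.stub_lowRungFilling → Sig.stub_windowFilling →
Sig.stub_fillingContractible → ThinSpheresBoundTwoHandlebodies` is the REAL composition
(sorry-free): rewrite the inline entropy hypothesis as `λ₄(range ι) < λ₄(Cyl₁)`; if
`λ₄(range ι) ≤ λ₄(Cyl₂)` use stub 1; otherwise `M` is compact
(`compactSpace_of_homotopyEquiv_sphere_four_of_chartedSpace`) and connected (path connected, by
`pathConnectedSpace_of_homotopyEquiv`), stub 2 gives the `2`-handlebody filling and stub 3 its
contractibility. `ThinSpheresBoundTwoHandlebodies_proof : ThinSpheresBoundTwoHandlebodies` is the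
skeleton in its final shape (depends on `sorryAx` only through the three `stub_*`).

Sorry-free extras: `boundsFilling_of_diffeomorph_sphere` (every `M ≅ S⁴` bounds the contractible
`0`-handle `𝔻⁵`), `lowRungFilling_of_CMS` (stub 1 from the named fact), and the BC5 special case
`ThinSpheresBoundTwoHandlebodies_roundSphere` (the crux for `M = S⁴` itself, any embedding).

## Disproof used / dead lines / negatives

`ledger crux ls stmt-SmoothPoincare4-3718`: no workfiles (no `Disproof.lean`, no earlier line) as
of 2026-08-17; `ledger negatives --problem SmoothPoincare4`: no refuted statement bears on G. The
route's refuter/grounder stamps (2026-08-15) record: entropy term non-degenerate (`ent(Cyl₁)`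
finite and positive), G "new/conditional: CMS2025 Thm 1.3/Cor 1.23 + Huisken/Stone + SunWangXue2025
Thm 1.1, modulo SWX Conj 1.4 (open); no MCF in tree" — this skeleton puts that conditional input
in exactly one stub (`stub_windowFilling`) and nothing open elsewhere.

## BC3 audit (this seat; raw outputs in the seat's NOTES.md `birth-certificate:`)

`lean check --json` rc 0 with `sorry` exactly in `stub_lowRungFilling`, `stub_windowFilling`,
`stub_fillingContractible` (sorry count 3 = stub count, zero elsewhere). Probes
`stub → ThinSpheresBoundTwoHandlebodies` and `stub → SmoothPoincare4` by
`first | exact? | simpa | aesop` (and the unfolded variant) FAIL for all three stubs (seat folder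
`bc/ThinSpheresBoundTwoHandlebodies_probe_{L,A,C}.lean`).
-/

set_option linter.dupNamespace false
set_option linter.unusedVariables false

noncomputable section

namespace Summit.SmoothPoincare4.SmoothPoincare4.Cruxes.ThinSpheresBoundTwoHandlebodies.Birth

open scoped Manifold ContDiff Topology ENNReal ContinuousMap
open Set Function MeasureTheory
open Literature.Topology.FourManifolds
open Literature.Geometry.Riemannian
open Summit.SmoothPoincare4.SmoothPoincare4.Theses.EntropyLadder

/-- Local notation: the round 4-sphere `S⁴ ⊂ ℝ⁵` with Mathlib's manifold structure. -/
local notation "𝕊⁴" => (Metric.sphere (0 : EuclideanSpace ℝ (Fin 5)) 1)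

/-! ### Stub signatures (`Sig.stub_*`; the registered stubs below restate them verbatim so that the
registered signatures are self-contained over tree declarations) -/

/-- STUB 1 SIGNATURE — RUNG 2 IN FILLING FORM: a homotopy 4-sphere embedded in `ℝ⁵` with
`λ₄(range ι) ≤ λ₄(S²(2) × ℝ²)` bounds a compact contractible `5`-dimensional `2`-handlebody.
Known modulo the named fact `ChodoshMantoulidisSchulze2025_lowEntropy_sphere_four`
(`lowRungFilling_of_CMS`). -/
def Sig.stub_lowRungFilling : Prop :=
  ∀ (M : Type) [TopologicalSpace M] [T2Space M] [SecondCountableTopology M]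
    [ChartedSpace (EuclideanSpace ℝ (Fin 4)) M] [IsManifold (𝓡 4) ∞ M],
    M ≃ₕ Metric.sphere (0 : EuclideanSpace ℝ (Fin 5)) 1 →
    ∀ ι : M → EuclideanSpace ℝ (Fin 5), Manifold.IsSmoothEmbedding (𝓡 4) (𝓡 5) ∞ ι →
    Literature.Geometry.Riemannian.gaussianEntropy 4 (Set.range ι) ≤
      Literature.Geometry.Riemannian.gaussianEntropy 4
        (Literature.Geometry.Riemannian.shrinkingCylinder 4 2) →
    ∃ (W : Type) (_ : TopologicalSpace W) (_ : T2Space W) (_ : SecondCountableTopology W)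
      (_ : ChartedSpace (EuclideanHalfSpace (4 + 1)) W) (_ : IsManifold (𝓡∂ (4 + 1)) ∞ W)
      (_ : CompactSpace W), ContractibleSpace W ∧
      Literature.Topology.FourManifolds.IsHandlebodyOfIndexLE 4 2 W ∧
      ∃ φ : M → W, Manifold.IsSmoothEmbedding (𝓡 4) (𝓡∂ (4 + 1)) ∞ φ ∧
        Set.range φ = (𝓡∂ (4 + 1)).boundary W

/-- STUB 2 SIGNATURE — THE WINDOW: a compact connected 4-manifold embedded in `ℝ⁵` with
`λ₄(S²(2) × ℝ²) < λ₄(range ι) < λ₄(S¹(√2) × ℝ³)` bounds a compact `5`-manifold with an adapted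
Morse function of index `≤ 2` (no contractibility claimed). Open: CMS 2025 Thm. 1.3 + SWX 2025
Cor. 1.3/1.6 modulo SWX Conjecture 1.4 below `λ(S¹)` in `ℝ⁵`. -/
def Sig.stub_windowFilling : Prop :=
  ∀ (M : Type) [TopologicalSpace M] [T2Space M] [SecondCountableTopology M] [CompactSpace M]
    [ConnectedSpace M] [ChartedSpace (EuclideanSpace ℝ (Fin 4)) M] [IsManifold (𝓡 4) ∞ M]
    (ι : M → EuclideanSpace ℝ (Fin 5)), Manifold.IsSmoothEmbedding (𝓡 4) (𝓡 5) ∞ ι →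
    Literature.Geometry.Riemannian.gaussianEntropy 4
        (Literature.Geometry.Riemannian.shrinkingCylinder 4 2) <
      Literature.Geometry.Riemannian.gaussianEntropy 4 (Set.range ι) →
    Literature.Geometry.Riemannian.gaussianEntropy 4 (Set.range ι) <
      Literature.Geometry.Riemannian.gaussianEntropy 4
        (Literature.Geometry.Riemannian.shrinkingCylinder 4 1) →
    ∃ (W : Type) (_ : TopologicalSpace W) (_ : T2Space W) (_ : SecondCountableTopology W)
      (_ : ChartedSpace (EuclideanHalfSpace (4 + 1)) W) (_ : IsManifold (𝓡∂ (4 + 1)) ∞ W)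
      (_ : CompactSpace W),
      Literature.Topology.FourManifolds.IsHandlebodyOfIndexLE 4 2 W ∧
      ∃ φ : M → W, Manifold.IsSmoothEmbedding (𝓡 4) (𝓡∂ (4 + 1)) ∞ φ ∧
        Set.range φ = (𝓡∂ (4 + 1)).boundary W

/-- STUB 3 SIGNATURE — TOPOLOGY OF THE FILLING: a compact `5`-manifold with an adapted Morse
function of index `≤ 2` whose boundary is an embedded homotopy 4-sphere is contractible
(connectedness, handles ⇒ `π₁(W) ≅ π₁(∂W) = 1`, Lefschetz duality ⇒ acyclic, Whitehead). -/
def Sig.stub_fillingContractible : Prop :=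
  ∀ (W : Type) [TopologicalSpace W] [T2Space W] [SecondCountableTopology W]
    [ChartedSpace (EuclideanHalfSpace (4 + 1)) W] [IsManifold (𝓡∂ (4 + 1)) ∞ W] [CompactSpace W],
    Literature.Topology.FourManifolds.IsHandlebodyOfIndexLE 4 2 W →
    ∀ (M : Type) [TopologicalSpace M] [T2Space M] [SecondCountableTopology M]
      [ChartedSpace (EuclideanSpace ℝ (Fin 4)) M] [IsManifold (𝓡 4) ∞ M],
      M ≃ₕ Metric.sphere (0 : EuclideanSpace ℝ (Fin 5)) 1 →
      ∀ φ : M → W, Manifold.IsSmoothEmbedding (𝓡 4) (𝓡∂ (4 + 1)) ∞ φ →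
        Set.range φ = (𝓡∂ (4 + 1)).boundary W → ContractibleSpace W

/-! ### Registered stubs (the ONLY `sorry`s of the file) -/

/-- **Stub 1 — rung 2 in filling form** (KNOWN modulo the tree's named fact
`ChodoshMantoulidisSchulze2025_lowEntropy_sphere_four`; sorry-free derivation
`lowRungFilling_of_CMS` below). If a homotopy 4-sphere `M` is smoothly embedded in `ℝ⁵` with
`λ₄(range ι) ≤ λ₄(S²(2) × ℝ²)` (`= 4/e`) then `M` bounds a compact contractible smooth
`5`-manifold with an adapted Morse function of index `≤ 2`. Why plausibly true: it IS
CMS 2025 Cor. 1.5 (b) (`n = 4`, unconditional: `M` simply connected with `λ ≤ λ(S²)` ⇒ `M ≅ S⁴`)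
followed by `S⁴ = ∂𝔻⁵` (`boundsFilling_of_diffeomorph_sphere`, proved). Size: nil beyond the named
fact. Sources: ChodoshMantoulidisSchulze2025 (arXiv:2309.03856, Cor. 1.5 (b), Cor. 1.22, proof
p. 6), DanielsHolgate2022, BernsteinWang2018, Stone1994. -/
theorem stub_lowRungFilling :
    ∀ (M : Type) [TopologicalSpace M] [T2Space M] [SecondCountableTopology M]
      [ChartedSpace (EuclideanSpace ℝ (Fin 4)) M] [IsManifold (𝓡 4) ∞ M],
      M ≃ₕ Metric.sphere (0 : EuclideanSpace ℝ (Fin 5)) 1 →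
      ∀ ι : M → EuclideanSpace ℝ (Fin 5), Manifold.IsSmoothEmbedding (𝓡 4) (𝓡 5) ∞ ι →
      Literature.Geometry.Riemannian.gaussianEntropy 4 (Set.range ι) ≤
        Literature.Geometry.Riemannian.gaussianEntropy 4
          (Literature.Geometry.Riemannian.shrinkingCylinder 4 2) →
      ∃ (W : Type) (_ : TopologicalSpace W) (_ : T2Space W) (_ : SecondCountableTopology W)
        (_ : ChartedSpace (EuclideanHalfSpace (4 + 1)) W) (_ : IsManifold (𝓡∂ (4 + 1)) ∞ W)
        (_ : CompactSpace W), ContractibleSpace W ∧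
        Literature.Topology.FourManifolds.IsHandlebodyOfIndexLE 4 2 W ∧
        ∃ φ : M → W, Manifold.IsSmoothEmbedding (𝓡 4) (𝓡∂ (4 + 1)) ∞ φ ∧
          Set.range φ = (𝓡∂ (4 + 1)).boundary W := by
  sorry

/-- **Stub 2 — the window filling** (OPEN; the load-bearing, hardest stub). Every compact
connected smooth `4`-manifold `M` embedded in `ℝ⁵` by `ι` with
`λ₄(S²(2) × ℝ²) < λ₄(range ι) < λ₄(S¹(√2) × ℝ³)` bounds a compact smooth `5`-manifold `W` carrying a
Morse function adapted to `∂W = M` with all critical points of index `≤ 2`. Why plausibly true: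
CMS 2025 Thm. 1.3 / Cor. 1.19 makes the flow of a `C^∞`-small normal graph `M' ≅ M` have only
multiplicity-one `S⁴, S³×ℝ, S²×ℝ²` singularities (`S¹×ℝ³` has density `λ(S¹) > λ(M')`, excluded by
Huisken monotonicity); if these are nondegenerate (Sun–Wang–Xue Conjecture 1.4, the open input;
locally generic by Sun–Xue 2022) the spacetime track is a compact `5`-manifold with boundary `M'`
built from balls by `1`- and `2`-handles (SWX 2025 Thm. 1.1, Cor. 1.3, Cor. 1.6: one `k`-handle per
`𝒞_{4,k}` singular point, time function Morse of index `5 - k`), i.e. `IsHandlebodyOfIndexLE 4 2`.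
Why it might fail: a robustly DEGENERATE bubble-sheet (`S² × ℝ²`) singularity below `λ(S¹)` in `ℝ⁵`
voids the mechanism (no surgery theory exists for `S² × ℝ²` necks); as a statement it predicts e.g.
that every closed `M⁴ ⊂ ℝ⁵` with `λ < 1.5203` has the fundamental group of a finite 2-complex
that is the boundary of a 5-dimensional 2-handlebody — no counterexample known. Sources:
ChodoshMantoulidisSchulze2025 (arXiv:2309.03856 Thm. 1.3, Cor. 1.19, Cor. 1.23), SunWangXue2025
(arXiv:2501.16678 Thm. 1.1, Cor. 1.3, Conj. 1.4, Cor. 1.6), SunXue2022 (arXiv:2210.00419),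
Huisken1990, Stone1994, ColdingMinicozzi2012. -/
theorem stub_windowFilling :
    ∀ (M : Type) [TopologicalSpace M] [T2Space M] [SecondCountableTopology M] [CompactSpace M]
      [ConnectedSpace M] [ChartedSpace (EuclideanSpace ℝ (Fin 4)) M] [IsManifold (𝓡 4) ∞ M]
      (ι : M → EuclideanSpace ℝ (Fin 5)), Manifold.IsSmoothEmbedding (𝓡 4) (𝓡 5) ∞ ι →
      Literature.Geometry.Riemannian.gaussianEntropy 4
          (Literature.Geometry.Riemannian.shrinkingCylinder 4 2) <
        Literature.Geometry.Riemannian.gaussianEntropy 4 (Set.range ι) →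
      Literature.Geometry.Riemannian.gaussianEntropy 4 (Set.range ι) <
        Literature.Geometry.Riemannian.gaussianEntropy 4
          (Literature.Geometry.Riemannian.shrinkingCylinder 4 1) →
      ∃ (W : Type) (_ : TopologicalSpace W) (_ : T2Space W) (_ : SecondCountableTopology W)
        (_ : ChartedSpace (EuclideanHalfSpace (4 + 1)) W) (_ : IsManifold (𝓡∂ (4 + 1)) ∞ W)
        (_ : CompactSpace W),
        Literature.Topology.FourManifolds.IsHandlebodyOfIndexLE 4 2 W ∧
        ∃ φ : M → W, Manifold.IsSmoothEmbedding (𝓡 4) (𝓡∂ (4 + 1)) ∞ φ ∧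
          Set.range φ = (𝓡∂ (4 + 1)).boundary W := by
  sorry

/-- **Stub 3 — a `5`-dimensional `2`-handlebody with homotopy-sphere boundary is contractible**
(KNOWN mathematics; size L–XL in Lean). If `W` is a compact smooth `5`-manifold with an adapted
Morse function of index `≤ 2` and `∂W` is the image of a smooth embedding of a homotopy 4-sphere
`M`, then `W` is contractible. Why true: `W ≠ ∅`; a closed component would have an interior
maximum, a critical point of index `5`; so `W` is connected; `W ≃` finite CW complex of dimension
`≤ 2` (`IsHandlebodyOfIndexLE.exists_finite_cwComplex_homotopyEquiv`, in the tree); the dual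
decomposition has handles of index `≥ 3`, so `π₁(W) ≅ π₁(∂W) = π₁(S⁴) = 1`; `H₂(W) = 0` from
`H₂(∂W) → H₂(W) → H₂(W, ∂W) ≅ H³(W) = 0` (Lefschetz); simply connected + acyclic ⇒ contractible
(Whitehead). Sources: Milnor1963 (Thm. 3.5), Milnor1965 (§3), Kosinski1993 (VII.1–4),
HatcherAT2002 (Thm. 3.43, Thm. 4.5, Cor. 4.33); tree: `HandlebodyCWStructure.lean`,
`NullCobordismBoundaryHomology.lean`, `NullCobordismHomotopyAssembly.lean`. -/
theorem stub_fillingContractible :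
    ∀ (W : Type) [TopologicalSpace W] [T2Space W] [SecondCountableTopology W]
      [ChartedSpace (EuclideanHalfSpace (4 + 1)) W] [IsManifold (𝓡∂ (4 + 1)) ∞ W]
      [CompactSpace W],
      Literature.Topology.FourManifolds.IsHandlebodyOfIndexLE 4 2 W →
      ∀ (M : Type) [TopologicalSpace M] [T2Space M] [SecondCountableTopology M]
        [ChartedSpace (EuclideanSpace ℝ (Fin 4)) M] [IsManifold (𝓡 4) ∞ M],
        M ≃ₕ Metric.sphere (0 : EuclideanSpace ℝ (Fin 5)) 1 →
        ∀ φ : M → W, Manifold.IsSmoothEmbedding (𝓡 4) (𝓡∂ (4 + 1)) ∞ φ →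
          Set.range φ = (𝓡∂ (4 + 1)).boundary W → ContractibleSpace W := by
  sorry

/-! ### Sorry-free infrastructure -/

/-- **Every `M ≅ S⁴` bounds the contractible `0`-handle `𝔻⁵`** (sorry-free): `W = 𝔻⁵` (the
tree's closed ball with boundary, `ClosedBall.lean`), contractible (convex), a handlebody of
index `≤ 0 ≤ 2` (`isHandlebodyOfIndexLE_closedBall`: `‖x‖²` is adapted Morse with one index-`0`
critical point), and `φ = (S⁴ ↪ 𝔻⁵) ∘ d` for a diffeomorphism `d : M ≅ S⁴` is a smooth embedding
(`isSmoothEmbedding_sphereInclusion'_holds`, `IsSmoothEmbedding.comp_diffeomorph`) onto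
`∂𝔻⁵ = S⁴` (`range_inclusion_eq_boundary`). [folklore] -/
theorem boundsFilling_of_diffeomorph_sphere
    (M : Type) [TopologicalSpace M] [T2Space M] [SecondCountableTopology M]
    [ChartedSpace (EuclideanSpace ℝ (Fin 4)) M] [IsManifold (𝓡 4) ∞ M]
    (hd : Nonempty (M ≃ₘ⟮𝓡 4, 𝓡 4⟯ Metric.sphere (0 : EuclideanSpace ℝ (Fin 5)) 1)) :
    ∃ (W : Type) (_ : TopologicalSpace W) (_ : T2Space W) (_ : SecondCountableTopology W)
      (_ : ChartedSpace (EuclideanHalfSpace (4 + 1)) W) (_ : IsManifold (𝓡∂ (4 + 1)) ∞ W)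
      (_ : CompactSpace W), ContractibleSpace W ∧
      Literature.Topology.FourManifolds.IsHandlebodyOfIndexLE 4 2 W ∧
      ∃ φ : M → W, Manifold.IsSmoothEmbedding (𝓡 4) (𝓡∂ (4 + 1)) ∞ φ ∧
        Set.range φ = (𝓡∂ (4 + 1)).boundary W := by
  obtain ⟨d⟩ := hd
  have hK : CompactSpace (Metric.closedBall (0 : EuclideanSpace ℝ (Fin (4 + 1))) 1) :=
    isCompact_iff_compactSpace.mp (isCompact_closedBall _ _)
  refine ⟨Metric.closedBall (0 : EuclideanSpace ℝ (Fin (4 + 1))) 1, inferInstance, inferInstance,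
    inferInstance, inferInstance, inferInstance, hK, ?_, isHandlebodyOfIndexLE_closedBall 4 2, ?_⟩
  · exact (convex_closedBall (0 : EuclideanSpace ℝ (Fin (4 + 1))) 1).contractibleSpace
      ⟨0, Metric.mem_closedBall_self zero_le_one⟩
  · refine ⟨Set.inclusion Metric.sphere_subset_closedBall ∘ d, ?_, ?_⟩
    · exact (isSmoothEmbedding_sphereInclusion'_holds 4).comp_diffeomorph d
    · rw [Set.range_comp, EquivLike.range_eq_univ, Set.image_univ]
      exact range_inclusion_eq_boundary 4

/-- **Stub 1 from the named fact** (sorry-free): CMS 2025 Cor. 1.5 (b), `n = 4`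
(`ChodoshMantoulidisSchulze2025_lowEntropy_sphere_four`, clause (b): simply connected, compact,
connected, `λ₄ ≤ λ₄(Cyl₂)` ⇒ `M ≅ S⁴`), with compactness
(`compactSpace_of_homotopyEquiv_sphere_four_of_chartedSpace`), path-connectedness
(`pathConnectedSpace_of_homotopyEquiv`) and simple connectivity
(`simplyConnectedSpace_of_homotopyEquiv_sphere_four simplyConnectedSpace_sphere_four_holds`) of a
homotopy 4-sphere, then `boundsFilling_of_diffeomorph_sphere`.
[cite: ChodoshMantoulidisSchulze2025, Cor. 1.5 (b) and Cor. 1.22 (n = 4)] -/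
theorem lowRungFilling_of_CMS (h : ChodoshMantoulidisSchulze2025_lowEntropy_sphere_four) :
    Sig.stub_lowRungFilling := by
  intro M _ _ _ _ _ e ι hι hle
  haveI : CompactSpace M := compactSpace_of_homotopyEquiv_sphere_four_of_chartedSpace M e
  haveI : PathConnectedSpace (Metric.sphere (0 : EuclideanSpace ℝ (Fin 5)) 1) :=
    pathConnectedSpace_sphere_four
  haveI : PathConnectedSpace M :=
    Literature.Topology.FourManifolds.pathConnectedSpace_of_homotopyEquiv e
  have hsc : SimplyConnectedSpace M :=
    simplyConnectedSpace_of_homotopyEquiv_sphere_four simplyConnectedSpace_sphere_four_holds M e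
  exact boundsFilling_of_diffeomorph_sphere M (h.of_le_shrinkingCylinder_two M hsc hι hle)

/-- **BC5 special case — the round sphere** (sorry-free): the crux's conclusion for `M = S⁴`
itself and ANY smooth embedding `ι : S⁴ → ℝ⁵` (the entropy hypothesis is not even needed): `S⁴`
bounds `𝔻⁵`. Shows the crux is inhabited-in-kind and its conclusion computes. [folklore] -/
theorem ThinSpheresBoundTwoHandlebodies_roundSphere
    (ι : (Metric.sphere (0 : EuclideanSpace ℝ (Fin 5)) 1) → EuclideanSpace ℝ (Fin 5))
    (hι : Manifold.IsSmoothEmbedding (𝓡 4) (𝓡 5) ∞ ι) :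
    ∃ (W : Type) (_ : TopologicalSpace W) (_ : T2Space W) (_ : SecondCountableTopology W)
      (_ : ChartedSpace (EuclideanHalfSpace (4 + 1)) W) (_ : IsManifold (𝓡∂ (4 + 1)) ∞ W)
      (_ : CompactSpace W), ContractibleSpace W ∧
      (∃ f : W → ℝ, Literature.Topology.FourManifolds.IsMorseAdapted (𝓡∂ (4 + 1)) f ∧
        ∀ z, Literature.Topology.FourManifolds.IsMCriticalPt (𝓡∂ (4 + 1)) f z →
          Literature.Topology.FourManifolds.morseIndex (𝓡∂ (4 + 1)) f z ≤ 2) ∧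
      ∃ φ : (Metric.sphere (0 : EuclideanSpace ℝ (Fin 5)) 1) → W,
        Manifold.IsSmoothEmbedding (𝓡 4) (𝓡∂ (4 + 1)) ∞ φ ∧
        Set.range φ = (𝓡∂ (4 + 1)).boundary W :=
  boundsFilling_of_diffeomorph_sphere _ ⟨Diffeomorph.refl (𝓡 4) _ ∞⟩

/-! ### Composition: the three stubs prove the crux BY NAME -/

/-- **The line closes the crux modulo the three registered stubs** (sorry-free, pure logic over
the stub signatures plus three proved tree lemmas): rewrite the inline entropy hypothesis as
`λ₄(range ι) < λ₄(Cyl₁)` (`gaussianEntropy_four_lt_iff`, `shrinkingCylinder_four_one`); below or at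
`λ₄(Cyl₂)` stub 1 gives the contractible filling; in the window, `M` is compact
(`compactSpace_of_homotopyEquiv_sphere_four_of_chartedSpace`) and connected
(`pathConnectedSpace_of_homotopyEquiv`), stub 2 gives a `2`-handlebody filling and stub 3 makes
it contractible. [bookkeeping] -/
theorem ThinSpheresBoundTwoHandlebodies_of :
    Sig.stub_lowRungFilling → Sig.stub_windowFilling → Sig.stub_fillingContractible →
      ThinSpheresBoundTwoHandlebodies := by
  intro hL hA hC M _ _ _ _ _ e ι hι hlt
  have hlt' : gaussianEntropy 4 (Set.range ι) < gaussianEntropy 4 (shrinkingCylinder 4 1) := by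
    rw [gaussianEntropy_four_lt_iff, shrinkingCylinder_four_one]
    exact hlt
  rcases le_or_gt (gaussianEntropy 4 (Set.range ι)) (gaussianEntropy 4 (shrinkingCylinder 4 2))
    with hle | hwin
  · -- rung 2: stub 1 gives the contractible 2-handlebody filling outright
    obtain ⟨W, i₁, i₂, i₃, i₄, i₅, i₆, hc, hW, φ, hφ, hr⟩ := hL M e ι hι hle
    obtain ⟨f, hf, hfi⟩ := hW
    exact ⟨W, i₁, i₂, i₃, i₄, i₅, i₆, hc, ⟨f, hf, hfi⟩, φ, hφ, hr⟩
  · -- the window: `M` is compact and connected, stub 2 fills, stub 3 contracts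
    haveI : CompactSpace M := compactSpace_of_homotopyEquiv_sphere_four_of_chartedSpace M e
    haveI : PathConnectedSpace (Metric.sphere (0 : EuclideanSpace ℝ (Fin 5)) 1) :=
      pathConnectedSpace_sphere_four
    haveI : PathConnectedSpace M :=
      Literature.Topology.FourManifolds.pathConnectedSpace_of_homotopyEquiv e
    obtain ⟨W, i₁, i₂, i₃, i₄, i₅, i₆, hW, φ, hφ, hr⟩ := hA M ι hι hwin hlt'
    have hc : ContractibleSpace W := hC W hW M e φ hφ hr
    obtain ⟨f, hf, hfi⟩ := hW
    exact ⟨W, i₁, i₂, i₃, i₄, i₅, i₆, hc, ⟨f, hf, hfi⟩, φ, hφ, hr⟩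

/-- The skeleton in its final shape: the crux BY NAME from the three registered stubs (it becomes
the crux proof when the last `stub_*` is discharged; until then it depends on `sorryAx` through
the stubs only — no `sorry` of its own). [bookkeeping] -/
theorem ThinSpheresBoundTwoHandlebodies_proof : ThinSpheresBoundTwoHandlebodies :=
  ThinSpheresBoundTwoHandlebodies_of stub_lowRungFilling stub_windowFilling stub_fillingContractible

end Summit.SmoothPoincare4.SmoothPoincare4.Cruxes.ThinSpheresBoundTwoHandlebodies.Birth

end
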